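import Literature.NumberTheory.Automorphic.CDTTheorem712
import Literature.NumberTheory.EllipticCurves.ModFiveCongruenceHesseFamily
import Literature.NumberTheory.EllipticCurves.ModThreeReducibleIffPsi3Root
import Literature.NumberTheory.EllipticCurves.GlobalMinimalModel
import Literature.NumberTheory.EllipticCurves.Tamagawa
import HarnessLib

/-!
# stub-ideation k1 (gen 2, FAMILY 1 — recognise & import) for `stub_switch` = `CDT_three_five_switch`

Sketch file of seat `sidea-stmt-ABC-11340-stub_switch-1-g2` (crux `FreyModularity`, stmt-ABC-11340,
line `Lines/Sketch.lean`).  Everything here is SORRY-FREE: the helper lemmas a prover should land are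
typed as `def … : Prop` ATOMS, and the theorems are the kernel-checked implications
ATOMS ⇒ `CDT_three_five_switch` (⇔ `stub_switch`, `Iff.rfl` in the skeleton).

Recognition.  `stub_switch` is Wiles' 3–5 switch (Wiles 1995 Ch. 5; Conrad–Diamond–Taylor 1999,
proof of Thm. 7.1.2, p. 556; Rubin, *Modularity of mod 5 representations* (Cornell–Silverman–Stevens
1997, Ch. XIX) Prop. 6, Prop. 11, Lemma 12 and §4).  The three standing hypotheses of the stub are used
by no printed proof.  With Fisher's explicit Hesse pencil (tree NAMED FACT
`HesseFamilyFive.thm132_geomTorsionFive_of_hesseFamily` = [Fisher2012Hessian] Thm. 13.2 (i), n = 5)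
the `5`-side is free, and the `3`-side is EXACTLY the condition `Irreducible Ψ₃(E')` over `ℚ`
(Rubin Prop. 6 + Lemma 5: for a curve over `ℚ`, `ρ̄_{E',3}|ℚ(√-3)` abs. irreducible ⟺ the image is
`GL₂(𝔽₃)` or the normaliser of a non-split Cartan ⟺ `Γ_ℚ` is transitive on the four `3`-torsion
lines ⟺ `Ψ₃` irreducible).  So the one residual Diophantine atom is the Hilbert-irreducibility
instance `HessePencilIrreduciblePsi3` (R_Ψ below); everything else is ≤ M-sized.
-/

set_option linter.dupNamespace false

namespace Summit.ABC.ABC.Cruxes.FreyModularity.StubSwitchK1G2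

open Literature.NumberTheory.EllipticCurves Literature.NumberTheory.EllipticCurves.HesseFamilyFive
open Literature.NumberTheory.Automorphic Literature.NumberTheory.GaloisRepresentations
open Literature.NumberTheory.Automorphic.BCDT WeierstrassCurve Polynomial Matrix
open Field

noncomputable section

/-! ## §0 Objects -/

/-- Fisher's Hesse member `E_{l,m} : y² = x³ − 27𝔠₄(l,m)x − 54𝔠₆(l,m)` over the invariants `(c₄, c₆)`
(tree polynomials `HesseFamilyFive.C4/C6/D`, [Fisher2012Hessian] §8). -/
abbrev member (c₄ c₆ l m : ℚ) : WeierstrassCurve ℚ :=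
  ⟨0, 0, 0, -27 * C4 c₄ c₆ l m, -54 * C6 c₄ c₆ l m⟩

/-- "`H = ρ̄(Γ_ℚ)` is transitive on `ℙ¹(𝔽₃)`": any nonzero vector is moved onto any line. -/
def Transitive (ρ : ModPGaloisRep ℚ (ZMod 3) 2) : Prop :=
  ∀ v w : Fin 2 → ZMod 3, v ≠ 0 → w ≠ 0 →
    ∃ (σ : absoluteGaloisGroup ℚ) (c : ZMod 3),
      ((ρ σ : GL (Fin 2) (ZMod 3)) : Matrix (Fin 2) (Fin 2) (ZMod 3)) *ᵥ v = c • w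

/-! ## §1 The atoms (helper lemmas to land; each `def … : Prop`) -/

/-- **Δ (PROVED below, `memberDelta_holds`):** discriminant of a member — Fisher's syzygy
`𝔠₄³ − 𝔠₆² = (c₄³ − c₆²)𝔇⁵` ([Fisher2012Hessian] §8 display (syz)); also job j344474 [1]. -/
def MemberDelta : Prop :=
  ∀ c₄ c₆ l m : ℚ, (member c₄ c₆ l m).Δ = 2 ^ 6 * 3 ^ 9 * ((c₄ ^ 3 - c₆ ^ 2) * D c₄ c₆ l m ^ 5)

set_option maxHeartbeats 4000000 in
/-- **Atom Δ DISCHARGED here (`ring`, ≈ 100 s on the farm):** `Δ(E_{l,m}) = 2⁶·3⁹·(c₄³ − c₆²)·𝔇(l,m)⁵`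
— Fisher's syzygy `𝔠₄³ − 𝔠₆² = (c₄³ − c₆²)𝔇⁵` for `n = 5` read through `Δ = −16(4a₄³ + 27a₆²)`.
[Fisher2012Hessian, §8 (syz)] -/
theorem memberDelta_holds : MemberDelta := by
  intro c₄ c₆ l m
  simp only [WeierstrassCurve.Δ, WeierstrassCurve.b₂, WeierstrassCurve.b₄, WeierstrassCurve.b₆,
    WeierstrassCurve.b₈, C4, C6, C4l, C4m, D, Dl, Dm, Dll, Dmm, Dlm, Dlll, Dllm, Dlmm, Dmmm]
  ring

/-- **G (M, finite group theory in `GL₂(𝔽₃)`):** a subgroup `H = ρ̄(Γ_ℚ)` with `det = χ̄₃` (so `det`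
takes the value `-1`) that is transitive on the four lines contains an element of order `8`.
(Subgroups transitive on `ℙ¹(𝔽₃)`: `C_ns ≅ C₈`, `Q₈`, `N(C_ns) = SD₁₆`, `SL₂`, `GL₂`; `det ≠ 1` kills
`Q₈`, `SL₂`.)  Slick route: pick `g` with `det g = -1`; if `tr g ≠ 0` then `g` has order `8`
(Cayley–Hamilton, atom F1); else conjugation by `g` inverts `H ∩ SL₂`, which is then cyclic of order
`≤ 6`, contradicting transitivity.  Brute-force certificate: job j344490 [G]. [Rubin 1997, Lemma 5] -/
def GroupLemma : Prop :=
  ∀ ρ : ModPGaloisRep ℚ (ZMod 3) 2,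
    (∀ σ : absoluteGaloisGroup ℚ,
      Matrix.GeneralLinearGroup.det (ρ σ) = modPCyclotomicCharacterZMod ℚ 3 σ) →
    Transitive ρ → ∃ σ₀ : absoluteGaloisGroup ℚ, orderOf (ρ σ₀) = 8

/-- **D (M, the dictionary):** `Irreducible Ψ₃` ⇒ `Γ_ℚ` transitive on the lines of `E[3]` in any frame.
Roots of `Ψ₃` in `ℚ̄` = `x`-coordinates of the `8` points of order `3`, two opposite points per root
(tree: `eval_divisionPolynomial_three_eq_zero_of_eq_some` and its converse in
`ModThreeReducibleIffPsi3Root`); `x(σ • P) = σ (x P)`; `Γ_ℚ` is transitive on the roots of an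
irreducible polynomial (Mathlib `Normal.minpoly_eq_iff_mem_orbit` on `ℚ̄/ℚ`). [Rubin 1997, proof of Prop. 6] -/
def Dictionary : Prop :=
  ∀ (W : WeierstrassCurve ℚ) [W.IsElliptic], Irreducible W.Ψ₃ →
    ∀ ρ₃ : ModPGaloisRep ℚ (ZMod 3) 2, W.IsTorsionGaloisRep 3 ρ₃ → Transitive ρ₃

/-- **T (the sharp `3`-side criterion = Rubin 1997 Prop. 6, direction we need):** `Irreducible Ψ₃(E)`
over `ℚ` ⇒ every framed `ρ̄_{E,3}` is absolutely irreducible on `Γ_{ℚ(√-3)}`.  PROVED below from G + D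
(`psiThreeCriterion_of`). Weaker target than surjectivity (k2/k3): the image `N(C_ns)` is allowed and
no `Δ ∉ ℚ×³` side condition is needed. -/
def PsiThreeCriterion : Prop :=
  ∀ (W : WeierstrassCurve ℚ) [W.IsElliptic], Irreducible W.Ψ₃ →
    ∀ ρ₃ : ModPGaloisRep ℚ (ZMod 3) 2, W.IsTorsionGaloisRep 3 ρ₃ → ρ₃.IsAbsIrreducibleOverSqrt (-3)

/-- **R_Ψ (the ONE residual atom; XL as a uniform theorem, decidable per instance):** every Hesse
pencil over `ℚ` has a nonsingular member whose `3`-division polynomial is irreducible over `ℚ`.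
Print: Wiles 1995 Ch. 5 / CDT 1999 p. 556 ("by Hilbert irreducibility") / Rubin 1997 §4 /
Rubin–Silverberg 1995 Thm 5.1 + Rmk 5.2; the generic fibre has Galois group `GL₂(𝔽₃)` because the
pencil is the universal curve over `X_E(5) ≅ ℙ¹` and `X(15) → X(5)` is geometrically connected.
Numerics (j344474 [3],[4]): for 7 sample curves (incl. `j = 0, 1728`, two case-B curves) every member
`(l,m) = (t,1)`, `|t| ≤ 4`, but one has irreducible `Ψ₃`; the bivariate `Ψ₃(E_{l,1})(x) ∈ ℚ[l][x]` is
irreducible of bidegree `(4, 40)` (HIT hypothesis) for all four curves tested. -/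
def HessePencilIrreduciblePsi3 : Prop :=
  ∀ c₄ c₆ : ℚ, c₄ ^ 3 ≠ c₆ ^ 2 →
    ∃ l m : ℚ, D c₄ c₆ l m ≠ 0 ∧ Irreducible (member c₄ c₆ l m).Ψ₃

/-- **O8 (IN TREE, PROVED — `Summit.ABC.ABC.Theorems.stub_absIrrNegThree_group` /
`isAbsIrreducibleOverSqrt_negThree_of_orderOf_eq_eight`, file
`Theorems/DefiniteXiFreyModularityStubAbsIrrNegThreeGroup.lean`; VERBATIM its statement, taken as a
hypothesis only because that module is not built on the farm snapshot used by this sketch):** an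
element of order `8` in the image of `ρ̄ : Γ_ℚ → GL₂(𝔽₃)` with `det ρ̄ = χ̄₃` makes `ρ̄|ℚ(√-3)`
absolutely irreducible. [ConradDiamondTaylor1999, proof of Thm. 7.1.2, p. 556] -/
def OrderEightCriterion : Prop :=
  ∀ (ρ : ModPGaloisRep ℚ (ZMod 3) 2), (∀ σ : absoluteGaloisGroup ℚ,
    Matrix.GeneralLinearGroup.det (ρ σ) = modPCyclotomicCharacterZMod ℚ 3 σ) →
    ∀ (σ₀ : absoluteGaloisGroup ℚ), orderOf (ρ σ₀) = 8 → ρ.IsAbsIrreducibleOverSqrt (-3)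

/-- **F1 (S, `decide`-sized):** in `GL₂(𝔽₃)`, `det g = -1` and `tr g ≠ 0` force `orderOf g = 8`
(`g² = (tr g)·g + 1`, so `g⁴ = -1`; `orderOf_eq_prime_pow`). [Manoharmayum 1999, Prop. 2.3.3] -/
def OrderEightOfTraceDet : Prop :=
  ∀ g : GL (Fin 2) (ZMod 3), Matrix.GeneralLinearGroup.det g = -1 →
    (g : Matrix (Fin 2) (Fin 2) (ZMod 3)).trace ≠ 0 → orderOf g = 8

/-- **F2 (M, the per-instance certificate):** ONE good prime `q ≡ 2 (mod 3)` with `3 ∤ a_q`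
(equivalently `3 ∤ #Ẽ(𝔽_q)`) makes every framed `ρ̄_{E,3}` absolutely irreducible over `ℚ(√-3)`:
`Frob_q` has `det = χ̄₃(Frob_q) = q = -1` and `tr = a_q ≠ 0` in `𝔽₃`, hence order `8` (F1), and the
tree's `Theorems.isAbsIrreducibleOverSqrt_negThree_of_orderOf_eq_eight` concludes.  Leans on
`trace_galoisRepTorsion_frobenius_eq`, `det_galoisRepTorsion_frobenius_eq` (tree, PROVED),
`exists_ideal_placeOver`, `IsArithFrobAt` supply, and the frame transport of `orderOf` as in
`Theorems.exists_orderOf_eq_eight_of_dvd_frobeniusTrace`.  CONVERSELY a curve with reducible `Ψ₃`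
never passes (eigenvalue in `𝔽₃` or trace `0`) — j344490 [b]. -/
def FrobeniusCertificate : Prop :=
  ∀ (W : WeierstrassCurve ℚ) [W.IsElliptic] [W.IsGloballyMinimal] (q : ℕ) [Fact q.Prime],
    q % 3 = 2 → W.HasGoodReductionAtPrime q → ¬ (3 : ℤ) ∣ W.frobeniusTrace q →
    ∀ ρ₃ : ModPGaloisRep ℚ (ZMod 3) 2, W.IsTorsionGaloisRep 3 ρ₃ → ρ₃.IsAbsIrreducibleOverSqrt (-3)

/-- **R_F (HIT-free residual for road B; per instance a point count):** some member of the pencil has a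
globally minimal model with a good prime `q ≡ 2 (3)`, `3 ∤ a_q`.  Equivalent to R_Ψ given T and
Chebotarev (j344490 [b]: on 300 random curves `Irreducible Ψ₃` ⟺ such a `q < 600` exists). -/
def HessePencilFrobeniusCert : Prop :=
  ∀ c₄ c₆ : ℚ, c₄ ^ 3 ≠ c₆ ^ 2 →
    ∃ (l m : ℚ) (C : VariableChange ℚ) (_ : (C • member c₄ c₆ l m).IsGloballyMinimal)
      (q : ℕ) (_ : Fact q.Prime), D c₄ c₆ l m ≠ 0 ∧ q % 3 = 2 ∧
      (C • member c₄ c₆ l m).HasGoodReductionAtPrime q ∧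
      ¬ (3 : ℤ) ∣ (C • member c₄ c₆ l m).frobeniusTrace q

/-! ## §2 Proved plumbing -/

/-- Transport of a framed `5`-torsion model along a `5`-congruence (k3's H1, reproduced). -/
theorem isTorsionGaloisRep_of_congr {W W' : WeierstrassCurve ℚ} (h : Congr W' W)
    {ρ : ModPGaloisRep ℚ (ZMod 5) 2} (hρ : W.IsTorsionGaloisRep 5 ρ) :
    W'.IsTorsionGaloisRep 5 ρ := by
  obtain ⟨e', he'⟩ := h
  obtain ⟨e, he⟩ := hρ
  refine ⟨e'.trans e, fun σ P => ?_⟩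
  rw [AddEquiv.trans_apply, AddEquiv.trans_apply, he', he]

/-- `c₄` of a member: `c₄(y² = x³ + a₄x + a₆) = -48 a₄ = 6⁴·𝔠₄`. -/
theorem c₄_member (c₄ c₆ l m : ℚ) : (member c₄ c₆ l m).c₄ = 6 ^ 4 * C4 c₄ c₆ l m := by
  simp only [WeierstrassCurve.c₄, WeierstrassCurve.b₂, WeierstrassCurve.b₄]; ring

/-- `c₆` of a member: `-864 a₆ = 6⁶·𝔠₆`. -/
theorem c₆_member (c₄ c₆ l m : ℚ) : (member c₄ c₆ l m).c₆ = 6 ^ 6 * C6 c₄ c₆ l m := by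
  simp only [WeierstrassCurve.c₆, WeierstrassCurve.b₂, WeierstrassCurve.b₄,
    WeierstrassCurve.b₆]; ring

/-- An elliptic curve has `c₄³ ≠ c₆²` (`1728 Δ = c₄³ − c₆²`). -/
theorem c₄_pow_three_ne (W : WeierstrassCurve ℚ) [W.IsElliptic] : W.c₄ ^ 3 ≠ W.c₆ ^ 2 := by
  intro h
  have hΔ : W.Δ ≠ 0 := W.isUnit_Δ.ne_zero
  apply hΔ
  have : (1728 : ℚ) * W.Δ = 0 := by rw [W.c_relation, h, sub_self]
  simpa using this

/-- A member with `𝔇 ≠ 0` over an elliptic base is elliptic (by the syzygy). -/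
theorem isElliptic_member {c₄ c₆ l m : ℚ} (hc : c₄ ^ 3 ≠ c₆ ^ 2)
    (hD : D c₄ c₆ l m ≠ 0) : (member c₄ c₆ l m).IsElliptic := by
  rw [WeierstrassCurve.isElliptic_iff, memberDelta_holds, isUnit_iff_ne_zero]
  exact mul_ne_zero (by norm_num) (mul_ne_zero (sub_ne_zero.mpr hc) (pow_ne_zero _ hD))

/-- **T from G + D** (sorry-free): Rubin's Prop. 6 in the direction the switch needs. -/
theorem psiThreeCriterion_of (h8 : OrderEightCriterion) (hG : GroupLemma) (hD : Dictionary) :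
    PsiThreeCriterion := by
  intro W _ hΨ ρ₃ hρ
  have hdet := W.det_eq_modPCyclotomicCharacter_of_isTorsionGaloisRep_holds 3 ρ₃ hρ
  obtain ⟨σ₀, hσ₀⟩ := hG ρ₃ hdet (hD W hΨ ρ₃ hρ)
  exact h8 ρ₃ hdet σ₀ hσ₀

/-! ## §3 Assemblies: atoms ⇒ `CDT_three_five_switch` (⇔ `stub_switch`) -/

/-- **Road A (Wiles/Rubin via Ψ₃):** Fisher 13.2(i) + T + R_Ψ ⇒ the switch (Δ is proved).  The three standing
hypotheses of the stub are not used. -/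
theorem switch_of_psi3 (hF : thm132_geomTorsionFive_of_hesseFamily)
    (hT : PsiThreeCriterion) (hR : HessePencilIrreduciblePsi3) : CDT_three_five_switch := by
  intro W _ _ _ ρ hρ _
  obtain ⟨l, m, hD, hΨ⟩ := hR W.c₄ W.c₆ (c₄_pow_three_ne W)
  haveI hW' : (member W.c₄ W.c₆ l m).IsElliptic := isElliptic_member (c₄_pow_three_ne W) hD
  have hc : Congr (member W.c₄ W.c₆ l m) W :=
    congr_of_directCertificate hF W (member W.c₄ W.c₆ l m) W.c₄ W.c₆ l m 6 (by norm_num) rfl rfl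
      (c₄_member _ _ _ _) (c₆_member _ _ _ _)
  obtain ⟨ρ₃, hρ₃⟩ := exists_isTorsionGaloisRep (member W.c₄ W.c₆ l m) 3
  exact ⟨member W.c₄ W.c₆ l m, hW', isTorsionGaloisRep_of_congr hc hρ, ρ₃, hρ₃,
    hT (member W.c₄ W.c₆ l m) hΨ ρ₃ hρ₃⟩

/-- **Road A, fully decomposed:** Fisher 13.2(i) + O8 (tree, proved) + G + D + R_Ψ ⇒ the switch. -/
theorem switch_of_atoms (hF : thm132_geomTorsionFive_of_hesseFamily)
    (h8 : OrderEightCriterion) (hG : GroupLemma) (hD : Dictionary)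
    (hR : HessePencilIrreduciblePsi3) : CDT_three_five_switch :=
  switch_of_psi3 hF (psiThreeCriterion_of h8 hG hD) hR

/-- **Road B (HIT-free, per-instance point count):** Fisher 13.2(i) + F2 + R_F ⇒ the switch.
`hsmul` is VERBATIM the tree theorem `WeierstrassCurve.isTorsionGaloisRep_smul`
(`MatarNekovar2019.IrreducibleOverQuadraticFieldClauseThreeProofs`, PROVED; not imported here to keep
the sketch light). -/
theorem switch_of_frobenius (hF : thm132_geomTorsionFive_of_hesseFamily)
    (hF2 : FrobeniusCertificate) (hR : HessePencilFrobeniusCert)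
    (hsmul : ∀ (X : WeierstrassCurve ℚ) (C : VariableChange ℚ) {n : ℕ} [Fact n.Prime]
      {ρ : ModPGaloisRep ℚ (ZMod n) 2}, X.IsTorsionGaloisRep n ρ → (C • X).IsTorsionGaloisRep n ρ) :
    CDT_three_five_switch := by
  intro W _ _ _ ρ hρ _
  obtain ⟨l, m, C, hmin, q, hq, hD, hq3, hgood, htr⟩ := hR W.c₄ W.c₆ (c₄_pow_three_ne W)
  haveI hW' : (member W.c₄ W.c₆ l m).IsElliptic := isElliptic_member (c₄_pow_three_ne W) hD
  have hc : Congr (member W.c₄ W.c₆ l m) W :=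
    congr_of_directCertificate hF W (member W.c₄ W.c₆ l m) W.c₄ W.c₆ l m 6 (by norm_num) rfl rfl
      (c₄_member _ _ _ _) (c₆_member _ _ _ _)
  haveI : (C • member W.c₄ W.c₆ l m).IsElliptic := by infer_instance
  obtain ⟨ρ₃, hρ₃⟩ := exists_isTorsionGaloisRep (member W.c₄ W.c₆ l m) 3
  exact ⟨member W.c₄ W.c₆ l m, hW', isTorsionGaloisRep_of_congr hc hρ, ρ₃, hρ₃,
    hF2 (C • member W.c₄ W.c₆ l m) q hq3 hgood htr ρ₃ (hsmul _ C hρ₃)⟩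

end

end Summit.ABC.ABC.Cruxes.FreyModularity.StubSwitchK1G2
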